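import Mathlib
import Summits.NavierStokesRegularity.NavierStokesRegularity.Theses.EfficiencyFloor
import HarnessLib

/-!
# Crux `EfficiencyFloor.ProductionEfficiencyDecay` (stmt-NavierStokesRegularity-22866), skeleton stub
# `stub_integrateEfficiency`: integrating the pointwise efficiency law

`--supports stmt-NavierStokesRegularity-22866` (registered BC3 skeleton of the crux, stub
`stub_integrateEfficiency`, signature verbatim).

Real analysis only. If `Z > 0` on `[t₁, T)` and at every `t ∈ [t₁, T)` the function `Z` has a derivative
`D(t) ≤ ε Z(t)³`, then for `t₁ ≤ s ≤ t < T`: `Z(s)⁻² − Z(t)⁻² ≤ 2ε (t − s)`. Proof: `g = Z⁻²` has derivative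
`−2D/Z³ ≥ −2ε`, so `τ ↦ g(τ) + 2ετ` is monotone on `[s, t]` (Mathlib's
`monotoneOn_of_hasDerivWithinAt_nonneg`).

This is the step that turns the POINTWISE efficiency decay `Ż ≤ (ε/2) Z³` (the crux proper,
`stub_depletionGivenBudget`, NOT proved anywhere) into the every-subwindow form of the route decl. Nothing
about Navier–Stokes is used or asserted here. [folklore]
-/

-- the problem directory repeats the summit name (`NavierStokesRegularity/NavierStokesRegularity`)
set_option linter.dupNamespace false

noncomputable section

open Set

namespace Summit.NavierStokesRegularity.NavierStokesRegularity.Theorems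

namespace ProductionEfficiencyDecay

/-- Derivative of `τ ↦ Z(τ)⁻¹ ^ 2`: `−2 D / Z³` where `D = Z'(τ)` and `Z(τ) ≠ 0`. [folklore] -/
theorem hasDerivAt_inv_sq {Z : ℝ → ℝ} {D τ : ℝ} (hZ : HasDerivAt Z D τ) (hne : Z τ ≠ 0) :
    HasDerivAt (fun y => (Z y)⁻¹ ^ 2) (-2 * D / Z τ ^ 3) τ := by
  have h : HasDerivAt (fun y => (Z y * Z y)⁻¹) (-(D * Z τ + Z τ * D) / (Z τ * Z τ) ^ 2) τ :=
    (hZ.mul hZ).inv (mul_ne_zero hne hne)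
  have hfun : (fun y => (Z y)⁻¹ ^ 2) = fun y => (Z y * Z y)⁻¹ := by
    funext y; rw [inv_pow, sq]
  rw [hfun]
  refine h.congr_deriv ?_
  field_simp
  ring

/-- **Integrating the efficiency law** (registered stub `stub_integrateEfficiency`, verbatim): if `Z > 0` on
`[t₁,T)` and `Z` has at every `t ∈ [t₁,T)` a derivative `D ≤ ε Z(t)³`, then
`Z(s)⁻² − Z(t)⁻² ≤ 2ε(t − s)` for `t₁ ≤ s ≤ t < T`. [folklore] -/
theorem stub_integrateEfficiency :
    ∀ (Zr : ℝ → ℝ) (t₁ T ε : ℝ), (∀ t ∈ Set.Ico t₁ T, 0 < Zr t) →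
      (∀ t ∈ Set.Ico t₁ T, ∃ D : ℝ, HasDerivAt Zr D t ∧ D ≤ ε * Zr t ^ 3) →
      ∀ s t : ℝ, t₁ ≤ s → s ≤ t → t < T → (Zr s)⁻¹ ^ 2 - (Zr t)⁻¹ ^ 2 ≤ 2 * ε * (t - s) := by
  intro Zr t₁ T ε hpos hder s t hs hst htT
  -- `f τ = Z(τ)⁻² + 2ετ` is monotone on `[s, t]`
  set f : ℝ → ℝ := fun τ => (Zr τ)⁻¹ ^ 2 + 2 * ε * τ with hf
  set f' : ℝ → ℝ := fun τ => -2 * deriv Zr τ / Zr τ ^ 3 + 2 * ε with hf'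
  have hsub : Icc s t ⊆ Ico t₁ T := fun τ hτ => ⟨hs.trans hτ.1, hτ.2.trans_lt htT⟩
  have hderf : ∀ τ ∈ Icc s t, HasDerivAt f (f' τ) τ := by
    intro τ hτ
    obtain ⟨D, hD, -⟩ := hder τ (hsub hτ)
    have hne : Zr τ ≠ 0 := (hpos τ (hsub hτ)).ne'
    have h1 : HasDerivAt f (-2 * D / Zr τ ^ 3 + 2 * ε * 1) τ :=
      (hasDerivAt_inv_sq hD hne).add ((hasDerivAt_id τ).const_mul (2 * ε))
    show HasDerivAt f (-2 * deriv Zr τ / Zr τ ^ 3 + 2 * ε) τ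
    rw [hD.deriv]
    exact h1.congr_deriv (by ring)
  have hnonneg : ∀ τ ∈ Icc s t, 0 ≤ f' τ := by
    intro τ hτ
    obtain ⟨D, hD, hDle⟩ := hder τ (hsub hτ)
    have hZ : 0 < Zr τ := hpos τ (hsub hτ)
    have hZ3 : 0 < Zr τ ^ 3 := pow_pos hZ 3
    show 0 ≤ -2 * deriv Zr τ / Zr τ ^ 3 + 2 * ε
    rw [hD.deriv]
    have : D / Zr τ ^ 3 ≤ ε := (div_le_iff₀ hZ3).2 hDle
    have h2 : -2 * D / Zr τ ^ 3 = -2 * (D / Zr τ ^ 3) := by ring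
    rw [h2]
    linarith
  have hmono : MonotoneOn f (Icc s t) := by
    refine monotoneOn_of_hasDerivWithinAt_nonneg (f' := f') (convex_Icc s t)
      (fun τ hτ => (hderf τ hτ).continuousAt.continuousWithinAt) (fun τ hτ => ?_) fun τ hτ => ?_
    · exact (hderf τ (interior_subset hτ)).hasDerivWithinAt
    · exact hnonneg τ (interior_subset hτ)
  have h := hmono (left_mem_Icc.2 hst) (right_mem_Icc.2 hst) hst
  simp only [hf] at h
  linarith

end ProductionEfficiencyDecay

end Summit.NavierStokesRegularity.NavierStokesRegularity.Theorems

end
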